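import Summits.QuantumFields.BalabanUV.Beta.GAN24.T2DriftEvenMemberOfWardLetters

/-!
# `BalabanUV.Beta.GAN24.SlavedDivRowsOfWardLetters` — binder row G-an2-4 ∕ (CONV-C), W-slot, the (α-0) parity re-cut: **THE SLAVED SLOT-DIVERGENCE ROWS OF THE EVEN
# MEMBERS AND OF THEIR DRIFTS — ALL LEVELS, ONE CONSTANT, ONE RATE, GEOMETRIC DRIFTS — FROM D1's RAW W-SLOT TABLE LAWS ALONE** (the four row families `Hh₁ Hh₂ Hh₁d Hh₂d`
# that MY FILE 3 `WrecAtEvenHalfRowsOfNaturalWindows` displays, i.e. (H3)∕(H3d) of the (Q-L) END in leaf-03 g66's `h₁∕h₂` currency; G-an2-4 formalisation swarm, leaf prover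
# `b2b-balaban-gan24-formalise-leaf-03`, gen 69; FILE 4 of the journal INTENT [LEAF03-G69-ONLINE] ∕ A-2 ∕ A-3)

NOT IN PRINT; OUR BOOKKEEPING ([folklore] composition BY NAME — the row half of `T2DriftHalfMemberOfLetterRows.rate_halfMember_three_of_letterRows`' own proof, cut before
its END; 0 `def`, 0 cited facts, 0 `def … : Prop`, 0 sorry).  HONEST FRAMING (cell contract, verbatim): «discharging `BetaPertH` makes Bałaban's UV stability UNCONDITIONAL — a
real constructive-QFT result; it is NOT the continuum limit and NOT the Clay problem.»  HONEST DEPENDENCY (verbatim): «continuum YM on T⁴ ⇐ BetaPertH ∧ nine spine estimates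
(0/9 proved); BetaPertH ⇐ (D1) ∧ (D4) ∧ CAP+tail; G-an2-4 gates asym, D1 and NE2/3/4.»

WHAT (`d = 3`, `2 ≤ Lc`, in-block root `r`, pin `cE = Lc⁴`, any `cVH cΛ cE₂ cB Tc`, off-diagonal `LocStencil₂` border `vh₂S`, `ε := 1`, `y_n := ½•(S̃₂(T₂)_n + 1•P S̃₂(T₂)_n)`):
**`exists_slavedDivRows_halfMember_three_of_wardLetters`** — `∃ δ₃ σ₁ σ₂ σ₁d σ₂d ν₃, 0 < δ₃ ∧ 0 ≤ ν₃ < 1 ∧ (∀ n, LocStencil₂ (fun _ p κ′ u′ ↦ divV (κ₁u₁ ↦ y_n κ₁ u₁ κ′ u′) p) σ₁ δ₃) ∧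
(∀ n, LocStencil₂ (fun κ u _ p ↦ divV (κ₁u₁ ↦ y_n κ u κ₁ u₁) p) σ₂ δ₃) ∧ (∀ n, … (y_{n+1} − y_n) … (σ₁d·ν₃^n) δ₃) ∧ (∀ n, … (σ₂d·ν₃^n) δ₃)` from EXACTLY: per level `l` D1's RAW
TABLE LAWS `hTL ∕ hTL″` for the comb member `T2RecAt … l` (first-order partner PINNED to `SpureRecAt 3 Lc ρ cE cVH cΛ l`, block generators PINNED to `diagK (½ • Σ_{v∈box} legInd ρ
(Lc•Y + v))`, FREE residual words `R_l R″_l` — parity-ODD: `hR hR″` — and lock constants `cH_l ≠ 0`), p2's two scalar rows `hcH` (`|(sf_l·sm_l)⁻¹·(cH_l)⁻¹| ≤ c₀`) and `hq`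
(the lock scalar is `l`-free), and the border data `hBff hBmm hB`.  DISCHARGED BY NAME INSIDE (as in the OWNER ∕ p2's `T2DriftEvenMemberOfWardLetters`): the S-slot rows `(hS,
hSall)` by the OWNER g22's `exists_hS_hSall_SrecAt_three`, the S-step slot letters `hE₁ hE₂` by p2 g45's `exists_evenRows_uniform_three`, their drifts `hEd₁ hEd₂` by
`exists_evenRowsDrift_uniform_three`, the commutator parity `hCm` by d1-leaf-05's `trK_SpureRecAt` ⨾ leaf-01's `parityEven_comm_of_oddRows`; then p2's F4 rows
(`source_rows_three_of_srecAt_rows`, shape AND one-step Cauchy half), member `0` by `locStencil₂_unitS₂_T2RecAt_zero` ⨾ `locStencil₂_halfTable` ⨾ leaf-01's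
`letterRow_fst∕snd_of_locStencil₂`, members `l+1` by leaf-01 g72 (b1) PART 4 `slotLetters_halfMember_succ_of_rows`, drifts `l = m+1` by PART 6a∕6b `slotLetters_halfMember_succ_sub_of_rows`
∕ `slotLetters_snd_…`, `l = 0` by `locStencil₂_diff`; merged by MY g66 `rows_of_zero_succ` and `driftRows_of_zero_succ` (`ν₃ := max ½ (max θb θE)`).  NO (Q-L) row and NO (C) is
read: the slot divergences of the comb members are SLAVED to first-order data.  Asserts NO value of any charge; the table laws, their residual parities and the two scalar rows
are HYPOTHESES here (theorems at the literal of record upstream: d1 ∕ an1 ∕ p2 — the next file discharges them exactly as `WrecAtEvenHalfRowsOfBorderLetters` ⨾ `…OfQLCSym` do);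
NOTHING of (Q-L) ∕ (C)sym ∕ (β) discharged; NEVER «G-an2-4 closed» as (CONV-C); NOT D1, NOT `BetaPertH`, NOT continuum, NOT Clay; not in print.
Unit `b2b-balaban-gan24-formalise-leaf-03` (gen 69), 2026-08-23.
-/

noncomputable section

open Finset
open scoped BigOperators
open Literature.MathematicalPhysics.QuantumFieldTheory
open Literature.MathematicalPhysics.QuantumFieldTheory.Balaban1983to89
open Literature.MathematicalPhysics.QuantumFieldTheory.Balaban1983to89.Beta
open ExpKernelCalculus (MKer shiftK BiLoc Decays comp)
open OneStepResolventKernel (Fib LocStencil)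
open OneStepKernelFamily (KInvStep)
open AffineAveraging (box toSite)
open AveragingMixedJetTables (mixFFAt)
open SecondOrderResponse (W2SymOfK)
open KernelWard (divV)
open BalabanCompositeJets (LocStencil₂ LocStencil₂.nonneg)
open BalabanStepJetsSucc (mmRead)
open BalabanStepW2 (K3OfK M2Of)
open Summit.QuantumFields.BalabanUV.Beta.TameKernelCalculus (trK)
open Summit.QuantumFields.BalabanUV.Beta.BorderedHessian (sgnK diagK)
open Summit.QuantumFields.BalabanUV.Beta.AveragingWardRootedStencils (legInd)
open Summit.QuantumFields.BalabanUV.Beta.HessKerDressedUnits (unitK unitS)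
open Summit.QuantumFields.BalabanUV.Beta.SecondOrderUnits (unitM unitS₂ unitM₂)
open Summit.QuantumFields.BalabanUV.Beta.AxialDressingRooted (coDressKBmAt)
open Summit.QuantumFields.BalabanUV.Beta.SpineRooted (T2RecAt SpureRecAt M1At e3OfK)
open Summit.QuantumFields.BalabanUV.Beta.SpineRecursivePureParity (trK_SpureRecAt)
open Summit.QuantumFields.BalabanUV.Beta.GAN24.CombesThomas (sfStep smStep)
open Summit.QuantumFields.BalabanUV.Beta.GAN24.BiStencilZeroMode (Tab)
open Summit.QuantumFields.BalabanUV.Beta.GAN24.WSlotCauchyOfShapes (locStencil₂_le_mono)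
open Summit.QuantumFields.BalabanUV.Beta.GAN24.TableDressingDefect (locStencil₂_diff)
open Summit.QuantumFields.BalabanUV.Beta.GAN24.T2ShapeEvenEnd (locStencil₂_halfTable)
open Summit.QuantumFields.BalabanUV.Beta.GAN24.T2HybridShapeEnd (locStencil₂_unitS₂_T2RecAt_zero)
open Summit.QuantumFields.BalabanUV.Beta.GAN24.T2RecSourceRows (source_rows_three_of_srecAt_rows)
open Summit.QuantumFields.BalabanUV.Beta.GAN24.HalfMemberCellOfDivergences (letterRow_fst_of_locStencil₂ letterRow_snd_of_locStencil₂)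
open Summit.QuantumFields.BalabanUV.Beta.GAN24.HalfMemberSlavedDivergence (parityEven_comm_of_oddRows)
open Summit.QuantumFields.BalabanUV.Beta.GAN24.HalfMemberSlavedDivergenceLetters (slotLetters_halfMember_succ_of_rows)
open Summit.QuantumFields.BalabanUV.Beta.GAN24.HalfMemberSlavedDivergenceDrift (slotLetters_halfMember_succ_sub_of_rows)
open Summit.QuantumFields.BalabanUV.Beta.GAN24.HalfMemberSlavedDivergenceDriftSnd (slotLetters_snd_halfMember_succ_sub_of_rows)
open Summit.QuantumFields.BalabanUV.Beta.GAN24.T2ShapeHalfMemberOfLetterRows (rows_of_zero_succ)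
open Summit.QuantumFields.BalabanUV.Beta.GAN24.T2DriftHalfMemberOfLetterRows (driftRows_of_zero_succ fstTab_sub sndTab_sub)
open Summit.QuantumFields.BalabanUV.Beta.GAN24.SrecAtSlotRowsFinal (exists_hS_hSall_SrecAt_three)
open Summit.QuantumFields.BalabanUV.Beta.GAN24.BlockCommutatorStepLetter (exists_evenRows_uniform_three)
open Summit.QuantumFields.BalabanUV.Beta.GAN24.BlockCommutatorStepLetterDrift (exists_evenRowsDrift_uniform_three)

namespace Summit.QuantumFields.BalabanUV.Beta.GAN24.SlavedDivRowsOfWardLetters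

variable {Lc : ℕ} [NeZero Lc] {r : Fin (3 + 1) → ℕ}

/-- NOT IN PRINT; OUR BOOKKEEPING.  **THE SLAVED SLOT-DIVERGENCE ROWS OF THE EVEN MEMBERS AND OF THEIR DRIFTS FROM D1's RAW TABLE LAWS** (`d = 3`, pin `cE = Lc⁴`, `ε := 1`):
all levels, one constant per family, one rate, geometric drifts — MY FILE 3's `Hh₁ Hh₂ Hh₁d Hh₂d` — from the table laws `hTL hTL″` (+ `hR hR″`, `cH_l ≠ 0`), p2's scalar rows
`hcH hq`, and the border data; (hS, hSall), (hE, hEd), hCm discharged by name inside. -/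
theorem exists_slavedDivRows_halfMember_three_of_wardLetters (hLc : 2 ≤ Lc) (hr : r ∈ box (3 + 1) Lc) (cE cVH cΛ cE₂ cB : ℝ) (hcE : cE = (Lc : ℝ) ^ (3 + 1))
    (Tc : Fin 4 → Fin 4 → Fin 4 → Fin 4 → ℝ)
    {vh₂S : (Fin (3 + 1) → (Fin (3 + 1) → ℤ) → Fin (3 + 1) → (Fin (3 + 1) → ℤ) → MKer (3 + 1) (Fib 3))}
    (hBff : ∀ κ u κ' u' x z (α β : Fin (3 + 1)), vh₂S κ u κ' u' x z (Sum.inl α) (Sum.inl β) = 0)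
    (hBmm : ∀ κ u κ' u' x z (μ ν : Fin (3 + 1)), vh₂S κ u κ' u' x z (Sum.inr μ) (Sum.inr ν) = 0)
    {CB δB : ℝ} (hB : LocStencil₂ vh₂S CB δB) (hδB : 0 < δB)
    {R R'' : ℕ → (Fin (3 + 1) → ℤ) → Fin (3 + 1) → (Fin (3 + 1) → ℤ) → MKer (3 + 1) (Fib 3)} {cH : ℕ → ℝ} (hcH0 : ∀ l, cH l ≠ 0) {c₀ : ℝ}
    (hcH : ∀ l, |(sfStep Lc l * smStep 3 Lc l)⁻¹ * (cH l)⁻¹| ≤ c₀)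
    (hTL : ∀ (l : ℕ) (Y : Fin (3 + 1) → ℤ) (κ' : Fin (3 + 1)) (u' : Fin (3 + 1) → ℤ),
      cH l • ∑ v ∈ box (3 + 1) Lc, divV (fun κ u => T2RecAt 3 Lc (toSite r) cE cVH cΛ cE₂ cB Tc vh₂S (mixFFAt (toSite r) Lc) l κ u κ' u') ((Lc : ℤ) • Y + toSite v)
        = comp (SpureRecAt 3 Lc (toSite r) cE cVH cΛ l κ' u') (diagK (((1 : ℝ) / 2) • ∑ v ∈ box (3 + 1) Lc, legInd (toSite r) ((Lc : ℤ) • Y + toSite v))) - comp (diagK (((1 : ℝ) / 2) • ∑ v ∈ box (3 + 1) Lc, legInd (toSite r) ((Lc : ℤ) • Y + toSite v))) (SpureRecAt 3 Lc (toSite r) cE cVH cΛ l κ' u') + R l Y κ' u')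
    (hTL'' : ∀ (l : ℕ) (Y : Fin (3 + 1) → ℤ) (κ : Fin (3 + 1)) (u : Fin (3 + 1) → ℤ),
      cH l • ∑ v ∈ box (3 + 1) Lc, divV (T2RecAt 3 Lc (toSite r) cE cVH cΛ cE₂ cB Tc vh₂S (mixFFAt (toSite r) Lc) l κ u) ((Lc : ℤ) • Y + toSite v)
        = comp (SpureRecAt 3 Lc (toSite r) cE cVH cΛ l κ u) (diagK (((1 : ℝ) / 2) • ∑ v ∈ box (3 + 1) Lc, legInd (toSite r) ((Lc : ℤ) • Y + toSite v))) - comp (diagK (((1 : ℝ) / 2) • ∑ v ∈ box (3 + 1) Lc, legInd (toSite r) ((Lc : ℤ) • Y + toSite v))) (SpureRecAt 3 Lc (toSite r) cE cVH cΛ l κ u) + R'' l Y κ u)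
    (hR : ∀ (l : ℕ) (Y : Fin (3 + 1) → ℤ) (κ : Fin (3 + 1)) (u : Fin (3 + 1) → ℤ), trK (R l Y κ u) = -sgnK (R l Y κ u))
    (hR'' : ∀ (l : ℕ) (Y : Fin (3 + 1) → ℤ) (κ : Fin (3 + 1)) (u : Fin (3 + 1) → ℤ), trK (R'' l Y κ u) = -sgnK (R'' l Y κ u))
    (hq : ∀ l, (sfStep Lc (l + 1) * smStep 3 Lc (l + 1))⁻¹ * (cH (l + 1))⁻¹ = (sfStep Lc l * smStep 3 Lc l)⁻¹ * (cH l)⁻¹) :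
    ∃ δ₃ σ₁ σ₂ σ₁d σ₂d ν₃ : ℝ, 0 < δ₃ ∧ 0 ≤ ν₃ ∧ ν₃ < 1 ∧
      (∀ n : ℕ, LocStencil₂ (fun (_ : Fin (3 + 1)) (p : Fin (3 + 1) → ℤ) (κ' : Fin (3 + 1)) (u' : Fin (3 + 1) → ℤ) =>
      divV (fun κ₁ u₁ => (((1 : ℝ) / 2) • (unitS₂ (sfStep Lc n) (smStep 3 Lc n) (T2RecAt 3 Lc (toSite r) cE cVH cΛ cE₂ cB Tc vh₂S (mixFFAt (toSite r) Lc) n) + (1 : ℝ) • fun κ u κ' u' => sgnK (trK ((unitS₂ (sfStep Lc n) (smStep 3 Lc n) (T2RecAt 3 Lc (toSite r) cE cVH cΛ cE₂ cB Tc vh₂S (mixFFAt (toSite r) Lc) n)) κ u κ' u')))) κ₁ u₁ κ' u') p) σ₁ δ₃) ∧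
      (∀ n : ℕ, LocStencil₂ (fun (κ : Fin (3 + 1)) (u : Fin (3 + 1) → ℤ) (_ : Fin (3 + 1)) (p : Fin (3 + 1) → ℤ) =>
      divV (fun κ₁ u₁ => (((1 : ℝ) / 2) • (unitS₂ (sfStep Lc n) (smStep 3 Lc n) (T2RecAt 3 Lc (toSite r) cE cVH cΛ cE₂ cB Tc vh₂S (mixFFAt (toSite r) Lc) n) + (1 : ℝ) • fun κ u κ' u' => sgnK (trK ((unitS₂ (sfStep Lc n) (smStep 3 Lc n) (T2RecAt 3 Lc (toSite r) cE cVH cΛ cE₂ cB Tc vh₂S (mixFFAt (toSite r) Lc) n)) κ u κ' u')))) κ u κ₁ u₁) p) σ₂ δ₃) ∧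
      (∀ n : ℕ, LocStencil₂ (fun (_ : Fin (3 + 1)) (p : Fin (3 + 1) → ℤ) (κ' : Fin (3 + 1)) (u' : Fin (3 + 1) → ℤ) =>
      divV (fun κ₁ u₁ => ((((1 : ℝ) / 2) • (unitS₂ (sfStep Lc (n + 1)) (smStep 3 Lc (n + 1)) (T2RecAt 3 Lc (toSite r) cE cVH cΛ cE₂ cB Tc vh₂S (mixFFAt (toSite r) Lc) (n + 1)) + (1 : ℝ) • fun κ u κ' u' => sgnK (trK ((unitS₂ (sfStep Lc (n + 1)) (smStep 3 Lc (n + 1)) (T2RecAt 3 Lc (toSite r) cE cVH cΛ cE₂ cB Tc vh₂S (mixFFAt (toSite r) Lc) (n + 1))) κ u κ' u'))))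
        - (((1 : ℝ) / 2) • (unitS₂ (sfStep Lc n) (smStep 3 Lc n) (T2RecAt 3 Lc (toSite r) cE cVH cΛ cE₂ cB Tc vh₂S (mixFFAt (toSite r) Lc) n) + (1 : ℝ) • fun κ u κ' u' => sgnK (trK ((unitS₂ (sfStep Lc n) (smStep 3 Lc n) (T2RecAt 3 Lc (toSite r) cE cVH cΛ cE₂ cB Tc vh₂S (mixFFAt (toSite r) Lc) n)) κ u κ' u'))))) κ₁ u₁ κ' u') p) (σ₁d * ν₃ ^ n) δ₃) ∧
      (∀ n : ℕ, LocStencil₂ (fun (κ : Fin (3 + 1)) (u : Fin (3 + 1) → ℤ) (_ : Fin (3 + 1)) (p : Fin (3 + 1) → ℤ) =>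
      divV (fun κ₁ u₁ => ((((1 : ℝ) / 2) • (unitS₂ (sfStep Lc (n + 1)) (smStep 3 Lc (n + 1)) (T2RecAt 3 Lc (toSite r) cE cVH cΛ cE₂ cB Tc vh₂S (mixFFAt (toSite r) Lc) (n + 1)) + (1 : ℝ) • fun κ u κ' u' => sgnK (trK ((unitS₂ (sfStep Lc (n + 1)) (smStep 3 Lc (n + 1)) (T2RecAt 3 Lc (toSite r) cE cVH cΛ cE₂ cB Tc vh₂S (mixFFAt (toSite r) Lc) (n + 1))) κ u κ' u'))))
        - (((1 : ℝ) / 2) • (unitS₂ (sfStep Lc n) (smStep 3 Lc n) (T2RecAt 3 Lc (toSite r) cE cVH cΛ cE₂ cB Tc vh₂S (mixFFAt (toSite r) Lc) n) + (1 : ℝ) • fun κ u κ' u' => sgnK (trK ((unitS₂ (sfStep Lc n) (smStep 3 Lc n) (T2RecAt 3 Lc (toSite r) cE cVH cΛ cE₂ cB Tc vh₂S (mixFFAt (toSite r) Lc) n)) κ u κ' u'))))) κ u κ₁ u₁) p) (σ₂d * ν₃ ^ n) δ₃) := by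
  have hLc1 : 1 ≤ Lc := le_trans (by norm_num) hLc
  have hε : |(1 : ℝ)| ≤ 1 := by norm_num
  -- the S-slot rows at the pin (the OWNER g22), hypothesis-free
  obtain ⟨Cs, cS, θS, δS, hθS0, hθS1, hδS, hall⟩ := exists_hS_hSall_SrecAt_three hLc hcE cVH cΛ
  obtain ⟨hS, hSall⟩ := hall r hr
  -- the two S-step slot letter rows at `ε = 1`, all levels, one constant (p2 g45), and their one-step drifts (p2 g45's drift twin)
  obtain ⟨CE, δE, hδE, hE⟩ := exists_evenRows_uniform_three (Lc := Lc) hLc hcE hr cVH cΛ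
    (cE₂ * (Lc : ℝ) ^ (2 * (3 + 1)) * ((Lc : ℝ) ^ (3 + 1))⁻¹ / 2) cH hcH R R''
  obtain ⟨CEd, θE, δE', hθE0, hθE1, hδE', hEd⟩ := exists_evenRowsDrift_uniform_three (Lc := Lc) hLc hcE hr cVH cΛ
    (cE₂ * (Lc : ℝ) ^ (2 * (3 + 1)) * ((Lc : ℝ) ^ (3 + 1))⁻¹ / 2) cH hcH hq R R''
  -- the commutator word of the odd-rowed first-order table with the diagonal generators is parity-even (d1-leaf-05 ⨾ leaf-01)
  have hCm : ∀ (l : ℕ) (Y : Fin (3 + 1) → ℤ) (κ : Fin (3 + 1)) (u : Fin (3 + 1) → ℤ),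
      trK (comp (SpureRecAt 3 Lc (toSite r) cE cVH cΛ l κ u) (diagK (((1 : ℝ) / 2) • ∑ v ∈ box (3 + 1) Lc, legInd (toSite r) ((Lc : ℤ) • Y + toSite v)))
          - comp (diagK (((1 : ℝ) / 2) • ∑ v ∈ box (3 + 1) Lc, legInd (toSite r) ((Lc : ℤ) • Y + toSite v))) (SpureRecAt 3 Lc (toSite r) cE cVH cΛ l κ u))
        = sgnK (comp (SpureRecAt 3 Lc (toSite r) cE cVH cΛ l κ u) (diagK (((1 : ℝ) / 2) • ∑ v ∈ box (3 + 1) Lc, legInd (toSite r) ((Lc : ℤ) • Y + toSite v)))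
          - comp (diagK (((1 : ℝ) / 2) • ∑ v ∈ box (3 + 1) Lc, legInd (toSite r) ((Lc : ℤ) • Y + toSite v))) (SpureRecAt 3 Lc (toSite r) cE cVH cΛ l κ u)) :=
    fun l Y κ u => parityEven_comm_of_oddRows (fun κ u => trK_SpureRecAt hLc1 hr cE cVH cΛ l κ u)
      (fun Y => ((1 : ℝ) / 2) • ∑ v ∈ box (3 + 1) Lc, legInd (toSite r) ((Lc : ℤ) • Y + toSite v)) Y κ u
  -- p2's F4: the dressed comb sources are uniformly `LocStencil₂` and Cauchy (from the S-slot rows)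
  obtain ⟨⟨Cb, δb, hδb, hbF4⟩, ⟨cb, θb, δb', hcb, hθb0, hθb1, hδb', hbd⟩⟩ :=
    source_rows_three_of_srecAt_rows hLc hr cE cVH cΛ cE₂ cB (vh₂S := vh₂S) hB hδB hS hSall hδS hθS0 hθS1
  -- THE COMMON RATE
  set δ₀ : ℝ := min (min δb δb') (min (min δE δE') δB) with hδ₀def
  have hδ₀ : 0 < δ₀ := lt_min (lt_min hδb hδb') (lt_min (lt_min hδE hδE') hδB)
  have hδ₀b : δ₀ ≤ δb := (min_le_left _ _).trans (min_le_left _ _)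
  have hδ₀b' : δ₀ ≤ δb' := (min_le_left _ _).trans (min_le_right _ _)
  have hδ₀E : δ₀ ≤ δE := ((min_le_right _ _).trans (min_le_left _ _)).trans (min_le_left _ _)
  have hδ₀E' : δ₀ ≤ δE' := ((min_le_right _ _).trans (min_le_left _ _)).trans (min_le_right _ _)
  have hδ₀B : δ₀ ≤ δB := (min_le_right _ _).trans (min_le_right _ _)
  -- THE COMMON CONTRACTION FACTOR (`≥ ½` to absorb the source lag)
  set θ₁ : ℝ := max (1 / 2 : ℝ) (max θb θE) with hθ₁def
  have hθ₁h : (1 / 2 : ℝ) ≤ θ₁ := le_max_left _ _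
  have hθ₁0 : 0 ≤ θ₁ := le_trans (by norm_num) hθ₁h
  have hθ₁1 : θ₁ < 1 := max_lt (by norm_num) (max_lt hθb1 hθE1)
  have hθb₁ : θb ≤ θ₁ := (le_max_left _ _).trans (le_max_right _ _)
  have hθE₁ : θE ≤ θ₁ := (le_max_right _ _).trans (le_max_right _ _)
  -- LEVEL ROWS: member 0 by its own shape, members l+1 by (b1) PART 4 at level l
  have h0 := locStencil₂_halfTable (locStencil₂_unitS₂_T2RecAt_zero (d := 3) (Lc := Lc) (toSite r) cE cVH cΛ cE₂ cB Tc (mixFFAt (toSite r) Lc) hB hδB.le le_rfl) hε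
  have h0₁ := letterRow_fst_of_locStencil₂ h0 hδB.le
  have h0₂ := letterRow_snd_of_locStencil₂ h0 hδB.le
  have hsucc := fun l => slotLetters_halfMember_succ_of_rows (d := 3) hLc1 hr cE cVH cΛ cE₂ cB Tc hBff hBmm ⟨CB, δB, hδB, hB⟩ l (hcH0 l) (hTL l) (hTL'' l)
    (hCm l) (hR l) (hR'' l) 1 hε hδ₀.le ((hbF4 l).mono hδ₀b) (((hE l).1).mono hδ₀E) (((hE l).2).mono hδ₀E)
  have h₁ := rows_of_zero_succ
    (T := fun l => (fun (_ : Fin (3 + 1)) (p : Fin (3 + 1) → ℤ) (κ' : Fin (3 + 1)) (u' : Fin (3 + 1) → ℤ) =>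
      divV (fun κ₁ u₁ => (((1 : ℝ) / 2) • (unitS₂ (sfStep Lc l) (smStep 3 Lc l) (T2RecAt 3 Lc (toSite r) cE cVH cΛ cE₂ cB Tc vh₂S (mixFFAt (toSite r) Lc) l) + (1 : ℝ) • fun κ u κ' u' => sgnK (trK ((unitS₂ (sfStep Lc l) (smStep 3 Lc l) (T2RecAt 3 Lc (toSite r) cE cVH cΛ cE₂ cB Tc vh₂S (mixFFAt (toSite r) Lc) l)) κ u κ' u')))) κ₁ u₁ κ' u') p))
    h0₁ (fun l => (hsucc l).1) hδ₀B le_rfl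
  have h₂ := rows_of_zero_succ
    (T := fun l => (fun (κ : Fin (3 + 1)) (u : Fin (3 + 1) → ℤ) (_ : Fin (3 + 1)) (p : Fin (3 + 1) → ℤ) =>
      divV (fun κ₁ u₁ => (((1 : ℝ) / 2) • (unitS₂ (sfStep Lc l) (smStep 3 Lc l) (T2RecAt 3 Lc (toSite r) cE cVH cΛ cE₂ cB Tc vh₂S (mixFFAt (toSite r) Lc) l) + (1 : ℝ) • fun κ u κ' u' => sgnK (trK ((unitS₂ (sfStep Lc l) (smStep 3 Lc l) (T2RecAt 3 Lc (toSite r) cE cVH cΛ cE₂ cB Tc vh₂S (mixFFAt (toSite r) Lc) l)) κ u κ' u')))) κ u κ₁ u₁) p))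
    h0₂ (fun l => (hsucc l).2) hδ₀B le_rfl
  -- DRIFT ROWS, l = m+1: PART 6a ∕ 6b at level m (F4's Cauchy half at one step, the letter drifts), then one constant `B·θ₁^m`
  have hK₁ : 0 ≤ (((3 : ℕ) : ℝ) + 1) * (Real.exp (3 * δ₀) + 1) := by positivity
  have hK₂ : 0 ≤ (((3 : ℕ) : ℝ) + 1) * (Real.exp δ₀ + 1) := by positivity
  have hds₁ : ∀ m, LocStencil₂ (fun (_ : Fin (3 + 1)) (p : Fin (3 + 1) → ℤ) (κ' : Fin (3 + 1)) (u' : Fin (3 + 1) → ℤ) =>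
      divV (fun κ₁ u₁ => ((((1 : ℝ) / 2) • (unitS₂ (sfStep Lc (m + 1 + 1)) (smStep 3 Lc (m + 1 + 1)) (T2RecAt 3 Lc (toSite r) cE cVH cΛ cE₂ cB Tc vh₂S (mixFFAt (toSite r) Lc) (m + 1 + 1)) + (1 : ℝ) • fun κ u κ' u' => sgnK (trK ((unitS₂ (sfStep Lc (m + 1 + 1)) (smStep 3 Lc (m + 1 + 1)) (T2RecAt 3 Lc (toSite r) cE cVH cΛ cE₂ cB Tc vh₂S (mixFFAt (toSite r) Lc) (m + 1 + 1))) κ u κ' u'))))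
        - (((1 : ℝ) / 2) • (unitS₂ (sfStep Lc (m + 1)) (smStep 3 Lc (m + 1)) (T2RecAt 3 Lc (toSite r) cE cVH cΛ cE₂ cB Tc vh₂S (mixFFAt (toSite r) Lc) (m + 1)) + (1 : ℝ) • fun κ u κ' u' => sgnK (trK ((unitS₂ (sfStep Lc (m + 1)) (smStep 3 Lc (m + 1)) (T2RecAt 3 Lc (toSite r) cE cVH cΛ cE₂ cB Tc vh₂S (mixFFAt (toSite r) Lc) (m + 1))) κ u κ' u'))))) κ₁ u₁ κ' u') p)
      (((((3 : ℕ) : ℝ) + 1) * (Real.exp (3 * δ₀) + 1) * cb + |CEd|) * θ₁ ^ m) δ₀ := by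
    intro m
    have h := slotLetters_halfMember_succ_sub_of_rows (d := 3) hLc1 hr cE cVH cΛ cE₂ cB Tc hBff hBmm ⟨CB, δB, hδB, hB⟩ m (hcH0 m) (hTL m) (hTL'' m)
      (hCm m) (hR m) (hR'' m) (hcH0 (m + 1)) (hTL (m + 1)) (hTL'' (m + 1)) (hCm (m + 1)) (hR (m + 1)) (hR'' (m + 1)) 1 hε hδ₀.le
      ((hbd m 1).mono hδ₀b') (((hEd m).1).mono hδ₀E')
    refine locStencil₂_le_mono h ?_ le_rfl
    have hp1 : θb ^ m ≤ θ₁ ^ m := pow_le_pow_left₀ hθb0 hθb₁ m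
    have hp2 : θE ^ m ≤ θ₁ ^ m := pow_le_pow_left₀ hθE0 hθE₁ m
    have a1 : (((3 : ℕ) : ℝ) + 1) * (Real.exp (3 * δ₀) + 1) * (cb * θb ^ m) ≤ (((3 : ℕ) : ℝ) + 1) * (Real.exp (3 * δ₀) + 1) * cb * θ₁ ^ m := by
      rw [mul_assoc _ cb]
      exact mul_le_mul_of_nonneg_left (mul_le_mul_of_nonneg_left hp1 hcb) hK₁
    have a2 : CEd * θE ^ m ≤ |CEd| * θ₁ ^ m :=
      (le_abs_self _).trans (by
        rw [abs_mul, abs_of_nonneg (pow_nonneg hθE0 m)]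
        exact mul_le_mul_of_nonneg_left hp2 (abs_nonneg _))
    exact (add_le_add a1 a2).trans (le_of_eq (by ring))
  have hds₂ : ∀ m, LocStencil₂ (fun (κ : Fin (3 + 1)) (u : Fin (3 + 1) → ℤ) (_ : Fin (3 + 1)) (p : Fin (3 + 1) → ℤ) =>
      divV (fun κ₁ u₁ => ((((1 : ℝ) / 2) • (unitS₂ (sfStep Lc (m + 1 + 1)) (smStep 3 Lc (m + 1 + 1)) (T2RecAt 3 Lc (toSite r) cE cVH cΛ cE₂ cB Tc vh₂S (mixFFAt (toSite r) Lc) (m + 1 + 1)) + (1 : ℝ) • fun κ u κ' u' => sgnK (trK ((unitS₂ (sfStep Lc (m + 1 + 1)) (smStep 3 Lc (m + 1 + 1)) (T2RecAt 3 Lc (toSite r) cE cVH cΛ cE₂ cB Tc vh₂S (mixFFAt (toSite r) Lc) (m + 1 + 1))) κ u κ' u'))))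
        - (((1 : ℝ) / 2) • (unitS₂ (sfStep Lc (m + 1)) (smStep 3 Lc (m + 1)) (T2RecAt 3 Lc (toSite r) cE cVH cΛ cE₂ cB Tc vh₂S (mixFFAt (toSite r) Lc) (m + 1)) + (1 : ℝ) • fun κ u κ' u' => sgnK (trK ((unitS₂ (sfStep Lc (m + 1)) (smStep 3 Lc (m + 1)) (T2RecAt 3 Lc (toSite r) cE cVH cΛ cE₂ cB Tc vh₂S (mixFFAt (toSite r) Lc) (m + 1))) κ u κ' u'))))) κ u κ₁ u₁) p)
      (((((3 : ℕ) : ℝ) + 1) * (Real.exp δ₀ + 1) * cb + |CEd|) * θ₁ ^ m) δ₀ := by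
    intro m
    have h := slotLetters_snd_halfMember_succ_sub_of_rows (d := 3) hLc1 hr cE cVH cΛ cE₂ cB Tc hBff hBmm ⟨CB, δB, hδB, hB⟩ m (hcH0 m) (hTL m) (hTL'' m)
      (hCm m) (hR m) (hR'' m) (hcH0 (m + 1)) (hTL (m + 1)) (hTL'' (m + 1)) (hCm (m + 1)) (hR (m + 1)) (hR'' (m + 1)) 1 hε hδ₀.le
      ((hbd m 1).mono hδ₀b') (((hEd m).2).mono hδ₀E')
    refine locStencil₂_le_mono h ?_ le_rfl
    have hp1 : θb ^ m ≤ θ₁ ^ m := pow_le_pow_left₀ hθb0 hθb₁ m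
    have hp2 : θE ^ m ≤ θ₁ ^ m := pow_le_pow_left₀ hθE0 hθE₁ m
    have a1 : (((3 : ℕ) : ℝ) + 1) * (Real.exp δ₀ + 1) * (cb * θb ^ m) ≤ (((3 : ℕ) : ℝ) + 1) * (Real.exp δ₀ + 1) * cb * θ₁ ^ m := by
      rw [mul_assoc _ cb]
      exact mul_le_mul_of_nonneg_left (mul_le_mul_of_nonneg_left hp1 hcb) hK₂
    have a2 : CEd * θE ^ m ≤ |CEd| * θ₁ ^ m :=
      (le_abs_self _).trans (by
        rw [abs_mul, abs_of_nonneg (pow_nonneg hθE0 m)]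
        exact mul_le_mul_of_nonneg_left hp2 (abs_nonneg _))
    exact (add_le_add a1 a2).trans (le_of_eq (by ring))
  -- DRIFT ROWS, all l: the first difference (levels 1 and 0, `locStencil₂_diff`) merged with the lagged rows
  have h₁' := driftRows_of_zero_succ
    (T := fun l => (fun (_ : Fin (3 + 1)) (p : Fin (3 + 1) → ℤ) (κ' : Fin (3 + 1)) (u' : Fin (3 + 1) → ℤ) =>
      divV (fun κ₁ u₁ => ((((1 : ℝ) / 2) • (unitS₂ (sfStep Lc (l + 1)) (smStep 3 Lc (l + 1)) (T2RecAt 3 Lc (toSite r) cE cVH cΛ cE₂ cB Tc vh₂S (mixFFAt (toSite r) Lc) (l + 1)) + (1 : ℝ) • fun κ u κ' u' => sgnK (trK ((unitS₂ (sfStep Lc (l + 1)) (smStep 3 Lc (l + 1)) (T2RecAt 3 Lc (toSite r) cE cVH cΛ cE₂ cB Tc vh₂S (mixFFAt (toSite r) Lc) (l + 1))) κ u κ' u'))))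
        - (((1 : ℝ) / 2) • (unitS₂ (sfStep Lc l) (smStep 3 Lc l) (T2RecAt 3 Lc (toSite r) cE cVH cΛ cE₂ cB Tc vh₂S (mixFFAt (toSite r) Lc) l) + (1 : ℝ) • fun κ u κ' u' => sgnK (trK ((unitS₂ (sfStep Lc l) (smStep 3 Lc l) (T2RecAt 3 Lc (toSite r) cE cVH cΛ cE₂ cB Tc vh₂S (mixFFAt (toSite r) Lc) l)) κ u κ' u'))))) κ₁ u₁ κ' u') p))
    (by simpa only [fstTab_sub] using locStencil₂_diff (hsucc 0).1 (h0₁.mono hδ₀B)) hds₁ (by positivity) hθ₁h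
  have h₂' := driftRows_of_zero_succ
    (T := fun l => (fun (κ : Fin (3 + 1)) (u : Fin (3 + 1) → ℤ) (_ : Fin (3 + 1)) (p : Fin (3 + 1) → ℤ) =>
      divV (fun κ₁ u₁ => ((((1 : ℝ) / 2) • (unitS₂ (sfStep Lc (l + 1)) (smStep 3 Lc (l + 1)) (T2RecAt 3 Lc (toSite r) cE cVH cΛ cE₂ cB Tc vh₂S (mixFFAt (toSite r) Lc) (l + 1)) + (1 : ℝ) • fun κ u κ' u' => sgnK (trK ((unitS₂ (sfStep Lc (l + 1)) (smStep 3 Lc (l + 1)) (T2RecAt 3 Lc (toSite r) cE cVH cΛ cE₂ cB Tc vh₂S (mixFFAt (toSite r) Lc) (l + 1))) κ u κ' u'))))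
        - (((1 : ℝ) / 2) • (unitS₂ (sfStep Lc l) (smStep 3 Lc l) (T2RecAt 3 Lc (toSite r) cE cVH cΛ cE₂ cB Tc vh₂S (mixFFAt (toSite r) Lc) l) + (1 : ℝ) • fun κ u κ' u' => sgnK (trK ((unitS₂ (sfStep Lc l) (smStep 3 Lc l) (T2RecAt 3 Lc (toSite r) cE cVH cΛ cE₂ cB Tc vh₂S (mixFFAt (toSite r) Lc) l)) κ u κ' u'))))) κ u κ₁ u₁) p))
    (by simpa only [sndTab_sub] using locStencil₂_diff (hsucc 0).2 (h0₂.mono hδ₀B)) hds₂ (by positivity) hθ₁h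
  exact ⟨δ₀, _, _, _, _, θ₁, hδ₀, hθ₁0, hθ₁1, h₁, h₂, h₁', h₂'⟩

end Summit.QuantumFields.BalabanUV.Beta.GAN24.SlavedDivRowsOfWardLetters

end
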